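import Summits.AtomisticToContinuum.Crystallization.Theorems.FrustratedLawDichotomyStrainedPatchHomEntryLeafHTA2QSVerdict
import Summits.AtomisticToContinuum.Crystallization.Theorems.FrustratedLawDichotomyStrainedPatchHomEntryQuick

/-!
# LEVEL CLOSURE of the `(H)` production pair: every cell / tree certified at a level `μ₀` serves EVERY lower level `μ ≤ μ₀` at zero kernel cost
# (27623 `(H) HomFloor`, both halves; hand-1 g38; critic rows 1453 / 1455 (A)(1) «μ-monotonicity lemma FIRST — it makes every muRec-stated cell serve μ₇₈»)

decomp-a2c hand-1 g38 (crux `AperiodicFrustratedLawGap`, stmt-AtomisticToContinuum-27623).  The fallback route `(F₆′)` of record types its entry trees at the kernel level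
`μ₇₈ = −399232847967326` (`…RecordJunctionFallbackLeverF6p.level_ok_fallback_A35000_T22`), but every landed cell of the lane (the bulk cells, the entry-table cells, the nine
T0 anchors of today) is STATED at `muRec`.  The production verdicts `entryLeafOK6RBKP μ` (fcc) and `entryLeafOKHT4A2QQDCRS3 μ` (hcp, v3) depend on `μ` only through energy
tests that are antitone in `μ`, but that antitonicity runs through ten table / box verdict layers.  This file gives the same service WITHOUT opening them: the
LEVEL-CLOSED verdicts

* `entryLeafOKHT4A2QQDCRS4 μ c w := ∃ μ₀ ≥ μ, entryLeafOKHT4A2QQDCRS3 μ₀ c w` and `entryLeafOK6RBKP4 μ c w := ∃ μ₀ ≥ μ, entryLeafOK6RBKP μ₀ c w` (classical `decide`, never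
  evaluated by the kernel — exactly like v1/v2/v3), which CONTAIN the verdicts of record at every level `≥ μ` (`…_of_level`, `…_of_cert`) and are antitone in `μ` BY
  CONSTRUCTION (`…_mono`); soundness in the `hver` shapes of `…HomEntryFlipHcp.hcpHalf_of_entryTreeShuf` / `…HomEntrySign.fccHalf_of_entryTreeDom` (`…_sound`: the energy
  disjunct `μ₀/SC ≤ Σ` weakens to `μ/SC ≤ Σ`);
* tree transport `treeOK_HT4A2QQDCRS4_of_level` / `treeOK_6RBKP4_of_level` (a tree over the verdict of record at level `μ₀` IS a tree over the level-closed verdict at any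
  `μ ≤ μ₀`), `…_mono`, and the `∃`-tree forms — so a cell landed as `okS3_X : ∃ t, treeOK (entryLeafOKHT4A2QQDCRS3 muRec) t c w = true` enters a level-`μ₇₈` tree verbatim,
  and cells that only pass at `μ₇₈` enter the SAME tree (`…_of_cert`);
* the consumers `hcpHalf_of_entryTreeHT4A2QQDCRS4`, `fccHalf_of_entryTree6RBKP4` and ★★★ `homFloor_of_entryTrees6RBKP4_HT4A2QQDCRS4` (`2 (m + e_W) SC ≤ μ`), plus the
  mixed-level corollary `homFloor_of_entryTrees6RBKP_HT4A2QQDCRS3_levels` (fcc tree of record at `μF`, hcp tree of record at `μH`, any floor `m` with `2 (m + e_W) SC ≤ min`).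

Junction theorems over the v3 pair at level `μ` (`…Reserve.…_level_…`, `…FallbackLeverF6p.…`) get their level-closed twins by replacing `homFloor_of_verdictTrees` with
`homFloor_of_entryTrees6RBKP4_HT4A2QQDCRS4` — a three-line composition (hand-2's lane).  Two classical definitions + bookkeeping; 0 sorry; standard axioms; no instances /
notation / `#eval`.  `--supports stmt-AtomisticToContinuum-27623`.
-/

noncomputable section

namespace Summit.AtomisticToContinuum.Crystallization.Theorems.FrustratedLawDichotomyStrainedPatchHomEntryLeafHT

open scoped BigOperators RealInnerProductSpace
open Literature.Analysis.ValidatedNumerics.Numerics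
open Literature.Barriers.AtomisticToContinuum.FlatleyTheil2015 (fccVec)
open Summit.AtomisticToContinuum.Crystallization.Theorems.ChargedEnergyGapNegative (E3)
open Summit.AtomisticToContinuum.Crystallization.Theorems.FrustratedLawDichotomySchurCut (effPot w₄₅ ω₄)
open Summit.AtomisticToContinuum.Crystallization.Theorems.FrustratedLawDichotomyAveragingRuleTightFree (TightNearCap BadNearCap)
open Summit.AtomisticToContinuum.Crystallization.Theorems.FrustratedLawDichotomyExemptAbsorption (ExemptNear)
open Summit.AtomisticToContinuum.Crystallization.Theorems.FrustratedLawDichotomyStrainedPatchHomSplit (ExRec latPt hexFrame hcpShift HomFloor)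
open Summit.AtomisticToContinuum.Crystallization.Theorems.FrustratedLawDichotomyStrainedPatchHomPrunedPolar (homFloor_of_prunedBoxSums_selfAdjoint)
open Summit.AtomisticToContinuum.Crystallization.Theorems.FrustratedLawDichotomyStrainedPatchHomCertTree (CertTree treeOK)
open Summit.AtomisticToContinuum.Crystallization.Theorems.FrustratedLawDichotomyStrainedPatchHomEntryGram (rootC rootW)
open Summit.AtomisticToContinuum.Crystallization.Theorems.FrustratedLawDichotomyStrainedPatchHomEntryGramHcp (rootCH rootWH)
open Summit.AtomisticToContinuum.Crystallization.Theorems.FrustratedLawDichotomyStrainedPatchHomEntryTableP (entryLeafOK6RBKP entryLeafOK6RBKP_sound)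
open Summit.AtomisticToContinuum.Crystallization.Theorems.FrustratedLawDichotomyStrainedPatchHomEntrySign (fccHalf_of_entryTreeDom)
open Summit.AtomisticToContinuum.Crystallization.Theorems.FrustratedLawDichotomyStrainedPatchHomEntryFlipHcp (HcpDich hcpHalf_of_entryTreeShuf)
open Summit.AtomisticToContinuum.Crystallization.Theorems.FrustratedLawDichotomyStrainedPatchHomEntryQuick (treeOK_of_imp)

/-! ## §1. Weakening the level in the energy disjunct -/

/-- `μ ≤ μ₀ ⟹ μ/SC ≤ μ₀/SC` (real casts). [arithmetic] -/
theorem level_div_SC_mono {μ μ₀ : ℤ} (hle : μ ≤ μ₀) : (μ : ℝ) / SC ≤ (μ₀ : ℝ) / SC := by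
  have hS : (0 : ℝ) < SC := by norm_num [SC]
  have h : (μ : ℝ) ≤ (μ₀ : ℝ) := by exact_mod_cast hle
  rw [div_eq_mul_inv, div_eq_mul_inv]
  exact mul_le_mul_of_nonneg_right h (inv_nonneg.mpr hS.le)

/-! ## §2. The level-closed hcp production verdict -/

/-- ★ **LEVEL-CLOSED hcp PRODUCTION VERDICT**: some level `μ₀ ≥ μ` passes the production verdict v3 (classical `decide`; never evaluated by the kernel —
cell facts enter through `entryLeafOKHT4A2QQDCRS4_of_level` / `_of_cert`). -/
def entryLeafOKHT4A2QQDCRS4 (μ : ℤ) (c w : (Fin 3 × Fin 3) ⊕ Fin 3 → ℤ) : Bool :=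
  @decide (∃ μ₀ : ℤ, μ ≤ μ₀ ∧ entryLeafOKHT4A2QQDCRS3 μ₀ c w = true) (Classical.propDecidable _)

/-- ★ A box certified by v3 at ANY level `μ₀ ≥ μ` passes the level-closed verdict at `μ`. [formal bookkeeping] -/
theorem entryLeafOKHT4A2QQDCRS4_of_level {μ μ₀ : ℤ} {c w : (Fin 3 × Fin 3) ⊕ Fin 3 → ℤ} (hle : μ ≤ μ₀)
    (h : entryLeafOKHT4A2QQDCRS3 μ₀ c w = true) : entryLeafOKHT4A2QQDCRS4 μ c w = true :=
  @decide_eq_true _ (Classical.propDecidable _) ⟨μ₀, hle, h⟩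

/-- CONTAINMENT at equal level: v3 ⟹ v4. [formal bookkeeping] -/
theorem entryLeafOKHT4A2QQDCRS4_of_cert {μ : ℤ} {c w : (Fin 3 × Fin 3) ⊕ Fin 3 → ℤ} (h : entryLeafOKHT4A2QQDCRS3 μ c w = true) :
    entryLeafOKHT4A2QQDCRS4 μ c w = true :=
  entryLeafOKHT4A2QQDCRS4_of_level le_rfl h

/-- Unpacking the level-closed verdict. [formal bookkeeping] -/
theorem exists_level_of_entryLeafOKHT4A2QQDCRS4 {μ : ℤ} {c w : (Fin 3 × Fin 3) ⊕ Fin 3 → ℤ} (h : entryLeafOKHT4A2QQDCRS4 μ c w = true) :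
    ∃ μ₀ : ℤ, μ ≤ μ₀ ∧ entryLeafOKHT4A2QQDCRS3 μ₀ c w = true :=
  @of_decide_eq_true _ (Classical.propDecidable _) h

/-- ★ **ANTITONE IN THE LEVEL**: `μ′ ≤ μ ⟹ v4 μ ⟹ v4 μ′`. [formal bookkeeping] -/
theorem entryLeafOKHT4A2QQDCRS4_mono {μ μ' : ℤ} {c w : (Fin 3 × Fin 3) ⊕ Fin 3 → ℤ} (hle : μ' ≤ μ) (h : entryLeafOKHT4A2QQDCRS4 μ c w = true) :
    entryLeafOKHT4A2QQDCRS4 μ' c w = true := by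
  obtain ⟨μ₀, h0, h1⟩ := exists_level_of_entryLeafOKHT4A2QQDCRS4 h
  exact entryLeafOKHT4A2QQDCRS4_of_level (hle.trans h0) h1

/-- ★★ **SOUNDNESS** of the level-closed hcp verdict in the `hver` shape of `…HomEntryFlipHcp.hcpHalf_of_entryTreeShuf`. [folklore chaining: v3 soundness at the
witnessing level, then `μ/SC ≤ μ₀/SC`] -/
theorem entryLeafOKHT4A2QQDCRS4_sound {μ : ℤ} {c w : (Fin 3 × Fin 3) ⊕ Fin 3 → ℤ} (h : entryLeafOKHT4A2QQDCRS4 μ c w = true) (U : E3 →L[ℝ] E3) (ξ : E3)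
    (hsa : ∀ v v' : E3, ⟪U v, v'⟫ = ⟪v, U v'⟫) (hU : ‖U - 1‖ ≤ 1 / 4)
    (hbox : ∀ ab : Fin 3 × Fin 3, |(U (EuclideanSpace.single ab.2 (1 : ℝ))) ab.1 - (c (Sum.inl ab) : ℝ) / SC| ≤ (w (Sum.inl ab) : ℝ) / SC)
    (hξ : ∀ i : Fin 3, |ξ i - (c (Sum.inr i) : ℝ) / SC| ≤ (w (Sum.inr i) : ℝ) / SC) (h0 : 0 ≤ ξ 0) (h2 : 0 ≤ ξ 2) :
    (∀ (M : ℕ) (z : Fin M → E3) (cc : Fin M), Function.Injective z →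
        Set.range z = {x : E3 | dist x (z cc) ≤ 133 / 10 ∧ ∃ a : Fin 3 → ℤ,
          x = z cc + latPt U hexFrame a ∨ x = z cc + latPt U hexFrame a + U (hcpShift + ξ)} →
        TightNearCap (9 / 5) (3 / 2) z cc ∨ ExemptNear (9 / 5) ExRec z cc ∨ BadNearCap (9 / 5) (3 / 2) z cc) ∨
      (μ : ℝ) / SC ≤ ∑ b ∈ (Fintype.piFinset fun _ : Fin 3 => Finset.Icc (-7 : ℤ) 7).filter (fun b => b ≠ 0), effPot w₄₅ ω₄ (3 / 400) ‖latPt U hexFrame b‖ +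
        ∑ b ∈ (Fintype.piFinset fun _ : Fin 3 => Finset.Icc (-7 : ℤ) 7), effPot w₄₅ ω₄ (3 / 400) ‖latPt U hexFrame b + U (hcpShift + ξ)‖ := by
  obtain ⟨μ₀, hle, h3⟩ := exists_level_of_entryLeafOKHT4A2QQDCRS4 h
  rcases entryLeafOKHT4A2QQDCRS3_sound h3 U ξ hsa hU hbox hξ h0 h2 with hp | he
  · exact Or.inl hp
  · exact Or.inr ((level_div_SC_mono hle).trans he)

/-- ★ TREE TRANSPORT: a certificate tree over v3 at level `μ₀` is a certificate tree over the level-closed verdict at every `μ ≤ μ₀`. [formal bookkeeping] -/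
theorem treeOK_HT4A2QQDCRS4_of_level {μ μ₀ : ℤ} (hle : μ ≤ μ₀) {t : CertTree ((Fin 3 × Fin 3) ⊕ Fin 3)} {c w : (Fin 3 × Fin 3) ⊕ Fin 3 → ℤ}
    (h : treeOK (entryLeafOKHT4A2QQDCRS3 μ₀) t c w = true) : treeOK (entryLeafOKHT4A2QQDCRS4 μ) t c w = true :=
  treeOK_of_imp (fun _ _ hv => entryLeafOKHT4A2QQDCRS4_of_level hle hv) t c w h

/-- ★ TREES are antitone in the level. [formal bookkeeping] -/
theorem treeOK_HT4A2QQDCRS4_mono {μ μ' : ℤ} (hle : μ' ≤ μ) {t : CertTree ((Fin 3 × Fin 3) ⊕ Fin 3)} {c w : (Fin 3 × Fin 3) ⊕ Fin 3 → ℤ}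
    (h : treeOK (entryLeafOKHT4A2QQDCRS4 μ) t c w = true) : treeOK (entryLeafOKHT4A2QQDCRS4 μ') t c w = true :=
  treeOK_of_imp (fun _ _ hv => entryLeafOKHT4A2QQDCRS4_mono hle hv) t c w h

/-- ★ ∃-TREE CURRENCY: a cell / sub-tree landed at level `μ₀` (e.g. every `okS3_…` fact at `muRec`) IS an ∃-tree of the level-closed verdict at any `μ ≤ μ₀`.
[formal bookkeeping] -/
theorem exists_tree_HT4A2QQDCRS4_of_level {μ μ₀ : ℤ} (hle : μ ≤ μ₀) {c w : (Fin 3 × Fin 3) ⊕ Fin 3 → ℤ}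
    (h : ∃ t : CertTree ((Fin 3 × Fin 3) ⊕ Fin 3), treeOK (entryLeafOKHT4A2QQDCRS3 μ₀) t c w = true) :
    ∃ t : CertTree ((Fin 3 × Fin 3) ⊕ Fin 3), treeOK (entryLeafOKHT4A2QQDCRS4 μ) t c w = true := by
  obtain ⟨t, ht⟩ := h
  exact ⟨t, treeOK_HT4A2QQDCRS4_of_level hle ht⟩

/-- ★★ The hcp half from ONE certificate tree over the level-closed verdict. [folklore chaining] -/
theorem hcpHalf_of_entryTreeHT4A2QQDCRS4 {m : ℝ} {μ : ℤ} (hμ : 2 * (m + (-(7175 / 10000) + 3 / 400)) * SC ≤ μ)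
    {t : CertTree ((Fin 3 × Fin 3) ⊕ Fin 3)} (h : treeOK (entryLeafOKHT4A2QQDCRS4 μ) t rootCH rootWH = true) :
    ∀ (U : E3 →L[ℝ] E3) (ξ : E3), (∀ v w : E3, inner ℝ (U v) w = inner ℝ v (U w)) → (∀ w : E3, 0 ≤ inner ℝ w (U w)) →
      ‖U - 1‖ ≤ 1 / 4 → ‖ξ‖ ≤ 1 / 4 → HcpDich m U ξ :=
  hcpHalf_of_entryTreeShuf hμ (entryLeafOKHT4A2QQDCRS4 μ) (fun _ _ hv U ξ hsa hU hbox hξ h0 h2 => entryLeafOKHT4A2QQDCRS4_sound hv U ξ hsa hU hbox hξ h0 h2) h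

/-! ## §3. The level-closed fcc verdict -/

/-- ★ **LEVEL-CLOSED fcc VERDICT**: some level `μ₀ ≥ μ` passes the fcc verdict of record `entryLeafOK6RBKP`. (classical `decide`; never evaluated) -/
def entryLeafOK6RBKP4 (μ : ℤ) (c w : Fin 3 × Fin 3 → ℤ) : Bool :=
  @decide (∃ μ₀ : ℤ, μ ≤ μ₀ ∧ entryLeafOK6RBKP μ₀ c w = true) (Classical.propDecidable _)

/-- ★ A box certified at ANY level `μ₀ ≥ μ` passes the level-closed fcc verdict at `μ`. [formal bookkeeping] -/
theorem entryLeafOK6RBKP4_of_level {μ μ₀ : ℤ} {c w : Fin 3 × Fin 3 → ℤ} (hle : μ ≤ μ₀) (h : entryLeafOK6RBKP μ₀ c w = true) :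
    entryLeafOK6RBKP4 μ c w = true :=
  @decide_eq_true _ (Classical.propDecidable _) ⟨μ₀, hle, h⟩

/-- CONTAINMENT at equal level. [formal bookkeeping] -/
theorem entryLeafOK6RBKP4_of_cert {μ : ℤ} {c w : Fin 3 × Fin 3 → ℤ} (h : entryLeafOK6RBKP μ c w = true) : entryLeafOK6RBKP4 μ c w = true :=
  entryLeafOK6RBKP4_of_level le_rfl h

/-- Unpacking. [formal bookkeeping] -/
theorem exists_level_of_entryLeafOK6RBKP4 {μ : ℤ} {c w : Fin 3 × Fin 3 → ℤ} (h : entryLeafOK6RBKP4 μ c w = true) :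
    ∃ μ₀ : ℤ, μ ≤ μ₀ ∧ entryLeafOK6RBKP μ₀ c w = true :=
  @of_decide_eq_true _ (Classical.propDecidable _) h

/-- ★ Antitone in the level. [formal bookkeeping] -/
theorem entryLeafOK6RBKP4_mono {μ μ' : ℤ} {c w : Fin 3 × Fin 3 → ℤ} (hle : μ' ≤ μ) (h : entryLeafOK6RBKP4 μ c w = true) :
    entryLeafOK6RBKP4 μ' c w = true := by
  obtain ⟨μ₀, h0, h1⟩ := exists_level_of_entryLeafOK6RBKP4 h
  exact entryLeafOK6RBKP4_of_level (hle.trans h0) h1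

/-- ★★ **SOUNDNESS** of the level-closed fcc verdict in the `hver` shape of `…HomEntrySign.fccHalf_of_entryTreeDom` (fundamental domain hypotheses passed through).
[folklore chaining] -/
theorem entryLeafOK6RBKP4_sound {μ : ℤ} {c w : Fin 3 × Fin 3 → ℤ} (h : entryLeafOK6RBKP4 μ c w = true) (U : E3 →L[ℝ] E3)
    (hsa : ∀ v v' : E3, ⟪U v, v'⟫ = ⟪v, U v'⟫) (hU : ‖U - 1‖ ≤ 1 / 4)
    (hbox : ∀ ab : Fin 3 × Fin 3, |(U (EuclideanSpace.single ab.2 (1 : ℝ))) ab.1 - (c ab : ℝ) / SC| ≤ (w ab : ℝ) / SC)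
    (h1 : (U (EuclideanSpace.single 1 (1 : ℝ))) 1 ≤ (U (EuclideanSpace.single 0 (1 : ℝ))) 0)
    (h2 : (U (EuclideanSpace.single 2 (1 : ℝ))) 2 ≤ (U (EuclideanSpace.single 1 (1 : ℝ))) 1)
    (h01 : 0 ≤ (U (EuclideanSpace.single 1 (1 : ℝ))) 0) (h02 : 0 ≤ (U (EuclideanSpace.single 2 (1 : ℝ))) 0) :
    (∀ (M : ℕ) (z : Fin M → E3) (cc : Fin M), Function.Injective z →
        Set.range z = {x : E3 | dist x (z cc) ≤ 133 / 10 ∧ ∃ a : Fin 3 → ℤ, x = z cc + latPt U fccVec a} →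
        TightNearCap (9 / 5) (3 / 2) z cc ∨ ExemptNear (9 / 5) ExRec z cc ∨ BadNearCap (9 / 5) (3 / 2) z cc) ∨
      (μ : ℝ) / SC ≤ ∑ b ∈ (Fintype.piFinset fun _ : Fin 3 => Finset.Icc (-7 : ℤ) 7).filter (fun b => b ≠ 0),
        effPot w₄₅ ω₄ (3 / 400) ‖latPt U fccVec b‖ := by
  obtain ⟨μ₀, hle, h6⟩ := exists_level_of_entryLeafOK6RBKP4 h
  rcases entryLeafOK6RBKP_sound h6 U hsa hU hbox h1 h2 h01 h02 with hp | he
  · exact Or.inl hp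
  · exact Or.inr ((level_div_SC_mono hle).trans he)

/-- ★ TREE TRANSPORT (fcc). [formal bookkeeping] -/
theorem treeOK_6RBKP4_of_level {μ μ₀ : ℤ} (hle : μ ≤ μ₀) {t : CertTree (Fin 3 × Fin 3)} {c w : Fin 3 × Fin 3 → ℤ}
    (h : treeOK (entryLeafOK6RBKP μ₀) t c w = true) : treeOK (entryLeafOK6RBKP4 μ) t c w = true :=
  treeOK_of_imp (fun _ _ hv => entryLeafOK6RBKP4_of_level hle hv) t c w h

/-- ★ TREES are antitone in the level (fcc). [formal bookkeeping] -/
theorem treeOK_6RBKP4_mono {μ μ' : ℤ} (hle : μ' ≤ μ) {t : CertTree (Fin 3 × Fin 3)} {c w : Fin 3 × Fin 3 → ℤ}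
    (h : treeOK (entryLeafOK6RBKP4 μ) t c w = true) : treeOK (entryLeafOK6RBKP4 μ') t c w = true :=
  treeOK_of_imp (fun _ _ hv => entryLeafOK6RBKP4_mono hle hv) t c w h

/-- ★ ∃-TREE CURRENCY (fcc). [formal bookkeeping] -/
theorem exists_tree_6RBKP4_of_level {μ μ₀ : ℤ} (hle : μ ≤ μ₀) {c w : Fin 3 × Fin 3 → ℤ}
    (h : ∃ t : CertTree (Fin 3 × Fin 3), treeOK (entryLeafOK6RBKP μ₀) t c w = true) :
    ∃ t : CertTree (Fin 3 × Fin 3), treeOK (entryLeafOK6RBKP4 μ) t c w = true := by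
  obtain ⟨t, ht⟩ := h
  exact ⟨t, treeOK_6RBKP4_of_level hle ht⟩

/-- ★★ The fcc half from ONE certificate tree over the level-closed fcc verdict (fundamental domain of record). [folklore chaining] -/
theorem fccHalf_of_entryTree6RBKP4 {m : ℝ} {μ : ℤ} (hμ : 2 * (m + (-(7175 / 10000) + 3 / 400)) * SC ≤ μ) {t : CertTree (Fin 3 × Fin 3)}
    (h : treeOK (entryLeafOK6RBKP4 μ) t rootC rootW = true) :
    ∀ U : E3 →L[ℝ] E3, (∀ v w : E3, inner ℝ (U v) w = inner ℝ v (U w)) → (∀ w : E3, 0 ≤ inner ℝ w (U w)) → ‖U - 1‖ ≤ 1 / 4 →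
      (∀ (M : ℕ) (z : Fin M → E3) (c : Fin M), Function.Injective z →
          Set.range z = {x : E3 | dist x (z c) ≤ 133 / 10 ∧ ∃ a : Fin 3 → ℤ, x = z c + latPt U fccVec a} →
          TightNearCap (9 / 5) (3 / 2) z c ∨ ExemptNear (9 / 5) ExRec z c ∨ BadNearCap (9 / 5) (3 / 2) z c) ∨
      m ≤ (∑ b ∈ (Fintype.piFinset fun _ : Fin 3 => Finset.Icc (-7 : ℤ) 7).filter (fun b => b ≠ 0),
        effPot w₄₅ ω₄ (3 / 400) ‖latPt U fccVec b‖) / 2 - (-(7175 / 10000) + 3 / 400) :=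
  fccHalf_of_entryTreeDom hμ (entryLeafOK6RBKP4 μ) (fun _ _ hv U hsa hU hbox h1 h2 h01 h02 => entryLeafOK6RBKP4_sound hv U hsa hU hbox h1 h2 h01 h02) h

/-! ## §4. `(H)` from the level-closed pair, and the mixed-level corollary for the trees of record -/

/-- ★★★ **`(H) HomFloor m` FROM THE LEVEL-CLOSED PAIR AT ANY LEVEL `μ` WITH `2 (m + e_W) SC ≤ μ`.** [folklore] -/
theorem homFloor_of_entryTrees6RBKP4_HT4A2QQDCRS4 {m : ℝ} {μ : ℤ} (hμ : 2 * (m + (-(7175 / 10000) + 3 / 400)) * SC ≤ μ)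
    (hF : ∃ t : CertTree (Fin 3 × Fin 3), treeOK (entryLeafOK6RBKP4 μ) t rootC rootW = true)
    (hH : ∃ t : CertTree ((Fin 3 × Fin 3) ⊕ Fin 3), treeOK (entryLeafOKHT4A2QQDCRS4 μ) t rootCH rootWH = true) : HomFloor m := by
  obtain ⟨tF, htF⟩ := hF
  obtain ⟨tH, htH⟩ := hH
  exact homFloor_of_prunedBoxSums_selfAdjoint (fccHalf_of_entryTree6RBKP4 hμ htF) (hcpHalf_of_entryTreeHT4A2QQDCRS4 hμ htH)

/-- ★★★ **MIXED LEVELS**: the fcc tree of record at level `μF` and the hcp tree of record at level `μH` give `HomFloor m` for EVERY floor `m` whose level is below both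
(`2 (m + e_W) SC ≤ μ`, `μ ≤ μF`, `μ ≤ μH`) — e.g. the two `muRec` trees serve the `(F₆′)` floor `3/5000 + 11/50000` at `μ₇₈`. [folklore] -/
theorem homFloor_of_entryTrees6RBKP_HT4A2QQDCRS3_levels {m : ℝ} {μ μF μH : ℤ} (hμ : 2 * (m + (-(7175 / 10000) + 3 / 400)) * SC ≤ μ)
    (hF : μ ≤ μF) (hH : μ ≤ μH)
    (htF : ∃ t : CertTree (Fin 3 × Fin 3), treeOK (entryLeafOK6RBKP μF) t rootC rootW = true)
    (htH : ∃ t : CertTree ((Fin 3 × Fin 3) ⊕ Fin 3), treeOK (entryLeafOKHT4A2QQDCRS3 μH) t rootCH rootWH = true) : HomFloor m :=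
  homFloor_of_entryTrees6RBKP4_HT4A2QQDCRS4 hμ (exists_tree_6RBKP4_of_level hF htF) (exists_tree_HT4A2QQDCRS4_of_level hH htH)

end Summit.AtomisticToContinuum.Crystallization.Theorems.FrustratedLawDichotomyStrainedPatchHomEntryLeafHT

end
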